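import Mathlib
import HarnessLib
import Summits.Ventures.LatticeQCDFlow.Exactness.KickedProductSequence

/-!
# The OMF4 step in a normed algebra is a step-indexed kicked product: the 11-stage word `K(Gᵥ) D(δᵣ) K(Gₗ) D(δθ) K(G_c) D(δ_c) K(G_c) D(δθ) K(Gₗ) D(δᵣ) K(Gᵥ)` iterated `n` times has the trajectory `plfSeqTraj` with 5-periodic merged kicks and drift lengths — the OMF4 twin of `KickedProductOmf2Step` (R1′, step 3′)

HONEST FRAMING: exact (Metropolis-corrected) sampling algorithms for lattice gauge theory;
figures of merit are autocorrelation/cost numbers at stated couplings and volumes; no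
continuum-physics claim.

Venture `LatticeQCDFlow` (cell pub-lqcd), topic `Exactness`, FANOUT row 9 (eng-latcore, GEN-25; the engine's
`hmc.HMC(f, β, 'omf4').trajectory(τ, nstep[, tau_jitter])` on 4D `SU(N)` — `integrators.py` scheme `omf4`: per step of size
`ε` the kicks `ϑε·F`, `λε·F`, `(½−λ−ϑ)ε·F` (twice), `λε·F`, `ϑε·F` and the drifts `ρε`, `θε`, `(1−2(θ+ρ))ε`, `θε`, `ρε`;
24-11's `omf4Word`).  NEW WORK of the cell over GEN-25's `KickedProductSequence.lean` (C1: `plfSeqTraj` with STEP-INDEXED kicks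
AND drift lengths, `PLFSeqBounds`).  This is the algebraic identification only; the two-trajectory estimate for step-indexed
DRIFT LENGTHS (the `Σ δs` form of `KickedProductSequenceTwoPoint`, one drift length being NEGATIVE for the engine's
coefficients) is the next file and is NOT written.  Mathlib + tree files only; nothing is cited as a fact; no number is claimed.

* §1 **`plfOmf4Step ex J Gᵥ Gₗ G_c δᵣ δθ δ_c`** (def, the 11-stage step), **`omf4Kicks Gᵥ Gₗ G_c : ℕ → 𝔸 → V`** (def: `Gᵥ` at
  index 0, `2Gᵥ` at positive multiples of 5, `Gₗ` at indices `≡ 1, 4`, `G_c` at indices `≡ 2, 3 (mod 5)`),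
  **`omf4Drifts δᵣ δθ δ_c : ℕ → ℝ`** (def: `δᵣ` at `≡ 0, 4`, `δθ` at `≡ 1, 3`, `δ_c` at `≡ 2 (mod 5)`), the index lemmas, and
  **`plfOmf4Step_iterate`**: `(plfOmf4Step)^[n] (1, p) = (W_{5n}, m_{5n} − Gᵥ W_{5n})` with
  `(W_k, m_k) = plfSeqTraj ex J (omf4Kicks …) (omf4Drifts …) p k`; `plfOmf4Step_iterate_fst` / `_snd`.
* §2 **`PLFSeqBounds.omf4`** — the merged kicks satisfy C1's standing hypotheses with `b = max (2bᵥ) (max bₗ b_c)`,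
  `K = max (2Kᵥ) (max Kₗ K_c)` whenever `Gᵥ` does (gen-18's `PLFBounds`, carrying the hypotheses on `ex`, `J`, `T`) and
  `Gₗ`, `G_c` are bounded and Lipschitz on `T`.

NOT CLAIMED: anything metric about the OMF4 trajectory (next file); floating point.
-/

noncomputable section

namespace Summit.Ventures.LatticeQCDFlow.Exactness

open Set NNReal Function

variable {𝔸 : Type*} [NormedRing 𝔸] [NormedAlgebra ℝ 𝔸]
variable {V : Type*} [NormedAddCommGroup V] [NormedSpace ℝ V]

/-! ## §1 The OMF4 step and its merged sequences -/

section Defs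

variable (ex : 𝔸 → 𝔸) (J : V →L[ℝ] 𝔸) (Gv Gl Gc : 𝔸 → V) (δr δθ δc : ℝ)

/-- **ONE OMF4 STEP IN THE ALGEBRA** (11 stages): kick `Gᵥ`, drift `δᵣ`, kick `Gₗ`, drift `δθ`, kick `G_c`, drift `δ_c`,
kick `G_c`, drift `δθ`, kick `Gₗ`, drift `δᵣ`, kick `Gᵥ` (kick `m ← m + G W`, drift `W ← ex (δ • J m) · W`). -/
def plfOmf4Step (z : 𝔸 × V) : 𝔸 × V :=
  let m₁ := z.2 + Gv z.1
  let W₁ := ex (δr • J m₁) * z.1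
  let m₂ := m₁ + Gl W₁
  let W₂ := ex (δθ • J m₂) * W₁
  let m₃ := m₂ + Gc W₂
  let W₃ := ex (δc • J m₃) * W₂
  let m₄ := m₃ + Gc W₃
  let W₄ := ex (δθ • J m₄) * W₃
  let m₅ := m₄ + Gl W₄
  let W₅ := ex (δr • J m₅) * W₄
  (W₅, m₅ + Gv W₅)

/-- **THE MERGED KICK SEQUENCE OF THE OMF4 WORD.** -/
def omf4Kicks : ℕ → 𝔸 → V := fun k =>
  if k = 0 then Gv
  else if k % 5 = 0 then fun W => (2 : ℝ) • Gv W
  else if k % 5 = 1 ∨ k % 5 = 4 then Gl else Gc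

/-- **THE DRIFT-LENGTH SEQUENCE OF THE OMF4 WORD.** -/
def omf4Drifts : ℕ → ℝ := fun k =>
  if k % 5 = 0 ∨ k % 5 = 4 then δr else if k % 5 = 1 ∨ k % 5 = 3 then δθ else δc

omit [NormedRing 𝔸] [NormedAlgebra ℝ 𝔸] in
/-- Index `0`. -/
@[simp] theorem omf4Kicks_zero : omf4Kicks Gv Gl Gc 0 = Gv := by simp [omf4Kicks]

omit [NormedRing 𝔸] [NormedAlgebra ℝ 𝔸] in
/-- Indices `≡ 1 (mod 5)`. -/
theorem omf4Kicks_one (q : ℕ) : omf4Kicks Gv Gl Gc (5 * q + 1) = Gl := by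
  have h : (5 * q + 1) % 5 = 1 := by omega
  simp [omf4Kicks, h]

omit [NormedRing 𝔸] [NormedAlgebra ℝ 𝔸] in
/-- Indices `≡ 2 (mod 5)`. -/
theorem omf4Kicks_two (q : ℕ) : omf4Kicks Gv Gl Gc (5 * q + 2) = Gc := by
  have h : (5 * q + 2) % 5 = 2 := by omega
  simp [omf4Kicks, h]

omit [NormedRing 𝔸] [NormedAlgebra ℝ 𝔸] in
/-- Indices `≡ 3 (mod 5)`. -/
theorem omf4Kicks_three (q : ℕ) : omf4Kicks Gv Gl Gc (5 * q + 3) = Gc := by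
  have h : (5 * q + 3) % 5 = 3 := by omega
  simp [omf4Kicks, h]

omit [NormedRing 𝔸] [NormedAlgebra ℝ 𝔸] in
/-- Indices `≡ 4 (mod 5)`. -/
theorem omf4Kicks_four (q : ℕ) : omf4Kicks Gv Gl Gc (5 * q + 4) = Gl := by
  have h : (5 * q + 4) % 5 = 4 := by omega
  simp [omf4Kicks, h]

omit [NormedRing 𝔸] [NormedAlgebra ℝ 𝔸] in
/-- Positive multiples of `5` carry `2Gᵥ`. -/
theorem omf4Kicks_five (q : ℕ) : omf4Kicks Gv Gl Gc (5 * q + 5) = fun W => (2 : ℝ) • Gv W := by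
  have h : (5 * q + 5) % 5 = 0 := by omega
  simp [omf4Kicks, h]

/-- Drift lengths at indices `≡ 0`. -/
theorem omf4Drifts_zero (q : ℕ) : omf4Drifts δr δθ δc (5 * q) = δr := by
  have h : (5 * q) % 5 = 0 := by omega
  simp [omf4Drifts, h]

/-- Drift lengths at indices `≡ 1`. -/
theorem omf4Drifts_one (q : ℕ) : omf4Drifts δr δθ δc (5 * q + 1) = δθ := by
  have h : (5 * q + 1) % 5 = 1 := by omega
  simp [omf4Drifts, h]

/-- Drift lengths at indices `≡ 2`. -/
theorem omf4Drifts_two (q : ℕ) : omf4Drifts δr δθ δc (5 * q + 2) = δc := by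
  have h : (5 * q + 2) % 5 = 2 := by omega
  simp [omf4Drifts, h]

/-- Drift lengths at indices `≡ 3`. -/
theorem omf4Drifts_three (q : ℕ) : omf4Drifts δr δθ δc (5 * q + 3) = δθ := by
  have h : (5 * q + 3) % 5 = 3 := by omega
  simp [omf4Drifts, h]

/-- Drift lengths at indices `≡ 4`. -/
theorem omf4Drifts_four (q : ℕ) : omf4Drifts δr δθ δc (5 * q + 4) = δr := by
  have h : (5 * q + 4) % 5 = 4 := by omega
  simp [omf4Drifts, h]

variable (p : V)

/-- **THE `n`-STEP OMF4 TRAJECTORY IS THE STEP-INDEXED KICKED PRODUCT WITH `5n` DRIFT FACTORS**: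
`(plfOmf4Step)^[n] (1, p) = (W_{5n}, m_{5n} − Gᵥ W_{5n})`. -/
theorem plfOmf4Step_iterate (n : ℕ) :
    (plfOmf4Step ex J Gv Gl Gc δr δθ δc)^[n] (1, p) =
      ((plfSeqTraj ex J (omf4Kicks Gv Gl Gc) (omf4Drifts δr δθ δc) p (5 * n)).1,
        (plfSeqTraj ex J (omf4Kicks Gv Gl Gc) (omf4Drifts δr δθ δc) p (5 * n)).2 -
          Gv (plfSeqTraj ex J (omf4Kicks Gv Gl Gc) (omf4Drifts δr δθ δc) p (5 * n)).1) := by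
  induction n with
  | zero => simp [plfSeqTraj]
  | succ n ih =>
    rw [Function.iterate_succ_apply', ih]
    set T := plfSeqTraj ex J (omf4Kicks Gv Gl Gc) (omf4Drifts δr δθ δc) p with hT
    set W := (T (5 * n)).1 with hW
    set m := (T (5 * n)).2 with hm
    -- stage 1
    have h1f : (T (5 * n + 1)).1 = ex (δr • J m) * W := by
      rw [hT, plfSeqTraj_succ_fst, omf4Drifts_zero]
    have h1s : (T (5 * n + 1)).2 = m + Gl (T (5 * n + 1)).1 := by
      rw [hT, plfSeqTraj_succ_snd, omf4Kicks_one]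
    -- stage 2
    have h2f : (T (5 * n + 2)).1 = ex (δθ • J (T (5 * n + 1)).2) * (T (5 * n + 1)).1 := by
      rw [hT, show 5 * n + 2 = 5 * n + 1 + 1 by ring, plfSeqTraj_succ_fst, omf4Drifts_one]
    have h2s : (T (5 * n + 2)).2 = (T (5 * n + 1)).2 + Gc (T (5 * n + 2)).1 := by
      rw [hT, show 5 * n + 2 = 5 * n + 1 + 1 by ring, plfSeqTraj_succ_snd, ← show 5 * n + 2 = 5 * n + 1 + 1 by ring,
        omf4Kicks_two]
    -- stage 3
    have h3f : (T (5 * n + 3)).1 = ex (δc • J (T (5 * n + 2)).2) * (T (5 * n + 2)).1 := by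
      rw [hT, show 5 * n + 3 = 5 * n + 2 + 1 by ring, plfSeqTraj_succ_fst, omf4Drifts_two]
    have h3s : (T (5 * n + 3)).2 = (T (5 * n + 2)).2 + Gc (T (5 * n + 3)).1 := by
      rw [hT, show 5 * n + 3 = 5 * n + 2 + 1 by ring, plfSeqTraj_succ_snd, ← show 5 * n + 3 = 5 * n + 2 + 1 by ring,
        omf4Kicks_three]
    -- stage 4
    have h4f : (T (5 * n + 4)).1 = ex (δθ • J (T (5 * n + 3)).2) * (T (5 * n + 3)).1 := by
      rw [hT, show 5 * n + 4 = 5 * n + 3 + 1 by ring, plfSeqTraj_succ_fst, omf4Drifts_three]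
    have h4s : (T (5 * n + 4)).2 = (T (5 * n + 3)).2 + Gl (T (5 * n + 4)).1 := by
      rw [hT, show 5 * n + 4 = 5 * n + 3 + 1 by ring, plfSeqTraj_succ_snd, ← show 5 * n + 4 = 5 * n + 3 + 1 by ring,
        omf4Kicks_four]
    -- stage 5
    have h5f : (T (5 * n + 5)).1 = ex (δr • J (T (5 * n + 4)).2) * (T (5 * n + 4)).1 := by
      rw [hT, show 5 * n + 5 = 5 * n + 4 + 1 by ring, plfSeqTraj_succ_fst, omf4Drifts_four]
    have h5s : (T (5 * n + 5)).2 = (T (5 * n + 4)).2 + (2 : ℝ) • Gv (T (5 * n + 5)).1 := by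
      rw [hT, show 5 * n + 5 = 5 * n + 4 + 1 by ring, plfSeqTraj_succ_snd, ← show 5 * n + 5 = 5 * n + 4 + 1 by ring,
        omf4Kicks_five]
    rw [show 5 * (n + 1) = 5 * n + 5 by ring, h5s, h5f, h4s, h4f, h3s, h3f, h2s, h2f, h1s, h1f]
    simp only [plfOmf4Step, sub_add_cancel, two_smul, Prod.mk.injEq, true_and]
    abel

/-- The configuration after `n` OMF4 steps is `W_{5n}`. -/
theorem plfOmf4Step_iterate_fst (n : ℕ) :
    ((plfOmf4Step ex J Gv Gl Gc δr δθ δc)^[n] (1, p)).1 =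
      (plfSeqTraj ex J (omf4Kicks Gv Gl Gc) (omf4Drifts δr δθ δc) p (5 * n)).1 := by
  rw [plfOmf4Step_iterate]

/-- The momentum after `n` OMF4 steps is `m_{5n} − Gᵥ W_{5n}`. -/
theorem plfOmf4Step_iterate_snd (n : ℕ) :
    ((plfOmf4Step ex J Gv Gl Gc δr δθ δc)^[n] (1, p)).2 =
      (plfSeqTraj ex J (omf4Kicks Gv Gl Gc) (omf4Drifts δr δθ δc) p (5 * n)).2 -
        Gv (plfSeqTraj ex J (omf4Kicks Gv Gl Gc) (omf4Drifts δr δθ δc) p (5 * n)).1 := by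
  rw [plfOmf4Step_iterate]

end Defs

/-! ## §2 Bounds on the merged kicks -/

section Bounds

variable {ex : 𝔸 → 𝔸} {J : V →L[ℝ] 𝔸} {Gv Gl Gc : 𝔸 → V} {T : Set 𝔸} {C bv bl bc Kv Kl Kc ρ η : ℝ}

omit [NormedRing 𝔸] [NormedAlgebra ℝ 𝔸] in
/-- Every index is `0`, a positive multiple of `5`, or `5q + r` with `r ∈ {1, 2, 3, 4}` — and the merged kick there. -/
theorem omf4Kicks_cases (k : ℕ) :
    omf4Kicks Gv Gl Gc k = Gv ∨ omf4Kicks Gv Gl Gc k = (fun W => (2 : ℝ) • Gv W) ∨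
      omf4Kicks Gv Gl Gc k = Gl ∨ omf4Kicks Gv Gl Gc k = Gc := by
  unfold omf4Kicks
  by_cases h0 : k = 0
  · simp [h0]
  · by_cases h5 : k % 5 = 0
    · simp [h0, h5]
    · by_cases h14 : k % 5 = 1 ∨ k % 5 = 4
      · simp [h0, h5, h14]
      · simp [h0, h5, h14]

/-- **THE MERGED OMF4 KICKS SATISFY THE STANDING HYPOTHESES** with `b = max (2bᵥ) (max bₗ b_c)`,
`K = max (2Kᵥ) (max Kₗ K_c)`. -/
theorem PLFSeqBounds.omf4 (hv : PLFBounds ex J Gv T C bv Kv ρ η) (hbl : ∀ W ∈ T, ‖Gl W‖ ≤ bl)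
    (hKl : ∀ W ∈ T, ∀ W' ∈ T, ‖Gl W - Gl W'‖ ≤ Kl * ‖W - W'‖) (hKl0 : 0 ≤ Kl) (hbc : ∀ W ∈ T, ‖Gc W‖ ≤ bc)
    (hKc : ∀ W ∈ T, ∀ W' ∈ T, ‖Gc W - Gc W'‖ ≤ Kc * ‖W - W'‖) :
    PLFSeqBounds ex J (omf4Kicks Gv Gl Gc) T C (max (2 * bv) (max bl bc)) (max (2 * Kv) (max Kl Kc)) ρ η where
  one_mem := hv.one_mem
  mul_mem := hv.mul_mem
  norm_le := hv.norm_le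
  one_le := hv.one_le
  force_le k W hW := by
    have hb := hv.force_bound_nonneg
    rcases omf4Kicks_cases (Gv := Gv) (Gl := Gl) (Gc := Gc) k with h | h | h | h <;> rw [h]
    · exact (hv.force_le W hW).trans ((by linarith : bv ≤ 2 * bv).trans (le_max_left _ _))
    · dsimp only
      rw [norm_smul, Real.norm_two]
      exact (mul_le_mul_of_nonneg_left (hv.force_le W hW) zero_le_two).trans (le_max_left _ _)
    · exact (hbl W hW).trans ((le_max_left _ _).trans (le_max_right _ _))
    · exact (hbc W hW).trans ((le_max_right _ _).trans (le_max_right _ _))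
  force_lip k W hW W' hW' := by
    have hK := hv.lip_nonneg
    have hn : 0 ≤ ‖W - W'‖ := norm_nonneg _
    rcases omf4Kicks_cases (Gv := Gv) (Gl := Gl) (Gc := Gc) k with h | h | h | h <;> rw [h]
    · refine (hv.force_lip W hW W' hW').trans (mul_le_mul_of_nonneg_right ?_ hn)
      exact (by linarith : Kv ≤ 2 * Kv).trans (le_max_left _ _)
    · dsimp only
      rw [← smul_sub, norm_smul, Real.norm_two]
      calc 2 * ‖Gv W - Gv W'‖ ≤ 2 * (Kv * ‖W - W'‖) := mul_le_mul_of_nonneg_left (hv.force_lip W hW W' hW') zero_le_two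
        _ = (2 * Kv) * ‖W - W'‖ := by ring
        _ ≤ max (2 * Kv) (max Kl Kc) * ‖W - W'‖ := mul_le_mul_of_nonneg_right (le_max_left _ _) hn
    · exact (hKl W hW W' hW').trans (mul_le_mul_of_nonneg_right ((le_max_left _ _).trans (le_max_right _ _)) hn)
    · exact (hKc W hW W' hW').trans (mul_le_mul_of_nonneg_right ((le_max_right _ _).trans (le_max_right _ _)) hn)
  lip_nonneg := hKl0.trans ((le_max_left _ _).trans (le_max_right _ _))
  ex_zero := hv.ex_zero
  ex_defect := hv.ex_defect
  defect_nonneg := hv.defect_nonneg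
  defect_le_one := hv.defect_le_one
  radius_nonneg := hv.radius_nonneg

end Bounds

end Summit.Ventures.LatticeQCDFlow.Exactness

end
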